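import Mathlib
import Summits.NavierStokesRegularity.NavierStokesRegularity.Theorems.EulerZoomLiouvillePowerGaugeEulerLiouvilleSelfSimilarCorankOneZeroCurve
import HarnessLib.Audit

/-!
# Rung C1 of the crux `EulerZoomLiouville.PowerGaugeEulerLiouville`: the kernel-line GRAPH form of the zero curve
# at a corank-one zero (step F1 of the top-node closure plan)

Route №10 `EulerZoomLiouville` (NavierStokesRegularity), crux E = stmt-NavierStokesRegularity-19832,
tenure rung C1 (exactly self-similar members), registered residue `stub_selfSimilarExtremal`.
Fifteenth file of the NODAL-CONTINUUM line (lineage ns-typeII-p1, gen 7).  The nodal-continuum exit analysis at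
the top bad node `z♭` (`false_of_topBadNode_of_arc` and the closure plan, evidence TOPNODE-CLOSURE-PLAN on the
crux item) works in the tube coordinates `y = Γ(σ) + ξ`, `σ = ⟪e, y − z♭⟫`, `ξ ⊥ e`, along a curve `Γ` through `z♭`
that is a GRAPH OVER THE KERNEL LINE (`⟪e, Γ(σ) − z♭⟫ = σ`) on which the field is PARALLEL to `e`.  Lineage
ns-typeII-p2's `NoDrift.exists_zeroCurve_of_corankOne` produces the zero curve in the chart parameter of
`Ψ(y) = W(y) + ⟪e, y − z₀⟫e`; here the same inverse-function argument with the modified chart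
`Ψ̃(y) = W(y) − ⟪e, W(y)⟫e + ⟪e, y − z₀⟫e` (transversal part of `W` plus the kernel coordinate) gives the graph
parametrisation directly:

* `exists_kernelGraph_of_corankOne` — `W : E → E` of class `C²` on a real Hilbert space, `W(z₀) = 0`, `e` a unit
  vector with `DW(z₀)e = 0`, and the modified bordered operator
  `T = DW(z₀) − ⟪e, DW(z₀)·⟫e + ⟪e, ·⟫e` a linear homeomorphism (for SYMMETRIC `DW(z₀)` with `ker = ℝe` this is
  the usual bordered operator `DW(z₀) + ⟪e,·⟫e`, `borderedEquiv_of_isSymmetric`): there are `δ, ρ > 0` and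
  `Γ : ℝ → E`, `C²` on `(−δ, δ)`, `Γ(0) = z₀`, `Γ'(0) = e`, with **`⟪e, Γ(σ) − z₀⟫ = σ`** and
  **`W(Γ(σ)) = ⟪e, W(Γ(σ))⟫ e`** for `|σ| < δ`, and every zero `y ∈ B(z₀, ρ)` of `W` is `Γ(⟪e, y − z₀⟫)`;
* `borderedEquiv_of_isSymmetric` — on `ℝ³`: a symmetric `A` with `Ae = 0` (`|e| = 1`) whose kernel meets `e^⊥`
  only in `0` has `A + ⟪e,·⟫e` invertible, and `⟪e, A·⟫ = 0` (so the modified and the usual bordered operators agree).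

WHAT THIS IS NOT: not NS, not E — inverse-function bookkeeping. [folklore]
-/

noncomputable section

open Set Filter Metric Function
open scoped Topology RealInnerProductSpace

-- flat `Theorems/<Route><Decl>…` files of one crux share the namespace of the crux (tree convention)
set_option linter.dupNamespace false

namespace Summit.NavierStokesRegularity.NavierStokesRegularity.Theorems.PowerGaugeEulerLiouville.NodalContinuum

open Summit.NavierStokesRegularity.NavierStokesRegularity.Theorems.PowerGaugeEulerLiouville.NoDrift

section Hilbert

variable {E : Type*} [NormedAddCommGroup E] [InnerProductSpace ℝ E]

/-- The transversal-part map `y ↦ W y − ⟪e, W y⟫ e` has derivative `v ↦ DW v − ⟪e, DW v⟫ e`. [folklore] -/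
theorem hasFDerivAt_sub_inner_smul {W : E → E} {W' : E →L[ℝ] E} {y : E} (hW : HasFDerivAt W W' y) (e : E) :
    HasFDerivAt (fun y : E => W y - (⟪e, W y⟫ : ℝ) • e) (W' - ((innerSL ℝ e).comp W').smulRight e) y := by
  have h1 : HasFDerivAt (fun y : E => (⟪e, W y⟫ : ℝ)) ((innerSL ℝ e).comp W') y := by
    have h := (hasFDerivAt_const e y).inner ℝ hW
    refine h.congr_fderiv ?_
    ext v
    simp [fderivInnerCLM_apply]
  exact hW.sub (h1.smul_const e)

variable [CompleteSpace E]

/-- **The zero set near a corank-one zero is a `C²` GRAPH OVER THE KERNEL LINE, on which the field is parallel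
to the kernel vector.**  `W : E → E` of class `C²`, `W(z₀) = 0`, `e` a unit vector with `DW(z₀)e = 0`, and
`T = DW(z₀) − ⟪e, DW(z₀)·⟫e + ⟪e,·⟫e` a linear homeomorphism.  Then there are `δ, ρ > 0` and `Γ : ℝ → E`,
`C²` on `(−δ, δ)`, `Γ(0) = z₀`, `Γ'(0) = e`, with `⟪e, Γ(σ) − z₀⟫ = σ` and `W(Γ σ) = ⟪e, W(Γ σ)⟫ e` for `|σ| < δ`,
and every zero `y ∈ B(z₀, ρ)` of `W` has `|⟪e, y − z₀⟫| < δ` and `y = Γ(⟪e, y − z₀⟫)`.  (Inverse function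
theorem for `Ψ̃(y) = W(y) − ⟪e, W(y)⟫e + ⟪e, y − z₀⟫e`, `Γ(σ) = Ψ̃⁻¹(σe)`; compare
`NoDrift.exists_zeroCurve_of_corankOne`.) [folklore] -/
theorem exists_kernelGraph_of_corankOne {W : E → E} (hW : ContDiff ℝ 2 W) {z₀ e : E} (hz₀ : W z₀ = 0)
    (he : ‖e‖ = 1) (hLe : fderiv ℝ W z₀ e = 0) (T : E ≃L[ℝ] E)
    (hT : (T : E →L[ℝ] E) = fderiv ℝ W z₀ - ((innerSL ℝ e).comp (fderiv ℝ W z₀)).smulRight e +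
      (innerSL ℝ e).smulRight e) :
    ∃ δ : ℝ, 0 < δ ∧ ∃ ρ : ℝ, 0 < ρ ∧ ∃ Γ : ℝ → E,
      ContDiffOn ℝ 2 Γ (Ioo (-δ) δ) ∧ Γ 0 = z₀ ∧ HasDerivAt Γ e 0 ∧
      (∀ σ ∈ Ioo (-δ) δ, ⟪e, Γ σ - z₀⟫ = σ) ∧
      (∀ σ ∈ Ioo (-δ) δ, W (Γ σ) = (⟪e, W (Γ σ)⟫ : ℝ) • e) ∧
      (∀ y ∈ ball z₀ ρ, W y = 0 → ⟪e, y - z₀⟫ ∈ Ioo (-δ) δ ∧ Γ ⟪e, y - z₀⟫ = y) := by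
  have hee : ⟪e, e⟫ = (1 : ℝ) := by rw [real_inner_self_eq_norm_sq, he]; norm_num
  -- the chart `Ψ̃`
  set Ψ : E → E := fun y => (W y - (⟪e, W y⟫ : ℝ) • e) + (⟪e, y - z₀⟫ : ℝ) • e with hΨdef
  have hΨ : ContDiff ℝ 2 Ψ :=
    (hW.sub ((contDiff_const.inner ℝ hW).smul contDiff_const)).add (contDiff_inner_sub_smul e z₀)
  have hΨ' : HasFDerivAt Ψ (T : E →L[ℝ] E) z₀ := by
    rw [hT]
    exact (hasFDerivAt_sub_inner_smul ((hW.differentiable (by norm_num)) z₀).hasFDerivAt e).add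
      (hasFDerivAt_inner_sub_smul e z₀ z₀)
  have hΨz₀ : Ψ z₀ = 0 := by simp [hΨdef, hz₀]
  have h2 : (2 : WithTop ℕ∞) ≠ 0 := by norm_num
  set H := hΨ.contDiffAt.toOpenPartialHomeomorph Ψ hΨ' h2 with hHdef
  have hHcoe : (H : E → E) = Ψ := ContDiffAt.toOpenPartialHomeomorph_coe hΨ.contDiffAt hΨ' h2
  have hz₀s : z₀ ∈ H.source := ContDiffAt.mem_toOpenPartialHomeomorph_source hΨ.contDiffAt hΨ' h2
  have h0t : (0 : E) ∈ H.target := by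
    have h := ContDiffAt.image_mem_toOpenPartialHomeomorph_target hΨ.contDiffAt hΨ' h2
    rwa [hΨz₀] at h
  have hsymm0 : H.symm 0 = z₀ := by
    have h := H.left_inv hz₀s
    rwa [hHcoe, hΨz₀] at h
  have hsymmC : ContDiffAt ℝ 2 H.symm 0 := by
    refine H.contDiffAt_symm (f₀' := T) h0t ?_ ?_
    · rw [hsymm0, hHcoe]; exact hΨ'
    · rw [hsymm0, hHcoe]; exact hΨ.contDiffAt
  have hsymmD : HasFDerivAt H.symm (T.symm : E →L[ℝ] E) 0 := by
    refine H.hasFDerivAt_symm h0t ?_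
    rw [hsymm0, hHcoe]; exact hΨ'
  obtain ⟨u, hu, hCu⟩ : ∃ u ∈ 𝓝 (0 : E), ContDiffOn ℝ 2 H.symm u := by
    obtain ⟨u, hu, -, hCu⟩ := hsymmC.contDiffWithinAt.contDiffOn (m := 2) le_rfl (by simp)
    rw [insert_eq_of_mem (mem_univ _), nhdsWithin_univ] at hu
    exact ⟨u, hu, hCu⟩
  obtain ⟨δ, hδ, hδu⟩ : ∃ δ : ℝ, 0 < δ ∧ ball (0 : E) δ ⊆ u ∩ H.target := by
    have h : u ∩ H.target ∈ 𝓝 (0 : E) := inter_mem hu (H.open_target.mem_nhds h0t)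
    obtain ⟨δ, hδ, hsub⟩ := Metric.mem_nhds_iff.1 h
    exact ⟨δ, hδ, hsub⟩
  obtain ⟨ρ₁, hρ₁, hρ₁s⟩ : ∃ ρ₁ : ℝ, 0 < ρ₁ ∧ ball z₀ ρ₁ ⊆ H.source :=
    Metric.mem_nhds_iff.1 (H.open_source.mem_nhds hz₀s)
  -- the curve
  set Γ : ℝ → E := fun σ => H.symm (σ • e) with hΓdef
  have hte : ∀ σ : ℝ, σ ∈ Ioo (-δ) δ → σ • e ∈ ball (0 : E) δ := by
    intro σ hσ
    rw [mem_ball, dist_zero_right, norm_smul, he, mul_one, Real.norm_eq_abs, abs_lt]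
    exact hσ
  have hΨΓ : ∀ σ ∈ Ioo (-δ) δ, Ψ (Γ σ) = σ • e := by
    intro σ hσ
    have htt : σ • e ∈ H.target := (hδu (hte σ hσ)).2
    have h := H.right_inv htt
    rw [hHcoe] at h
    exact h
  -- the kernel coordinate of `Γ σ` is `σ`
  have hcoord : ∀ σ ∈ Ioo (-δ) δ, ⟪e, Γ σ - z₀⟫ = σ := by
    intro σ hσ
    have h := congrArg (fun v => (⟪e, v⟫ : ℝ)) (hΨΓ σ hσ)
    simp only [hΨdef, inner_add_right, inner_sub_right, inner_smul_right, hee, mul_one] at h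
    rw [inner_sub_right]
    linarith
  -- the field is parallel to `e` along `Γ`
  have hpar : ∀ σ ∈ Ioo (-δ) δ, W (Γ σ) = (⟪e, W (Γ σ)⟫ : ℝ) • e := by
    intro σ hσ
    have h := hΨΓ σ hσ
    simp only [hΨdef] at h
    rw [hcoord σ hσ] at h
    -- `W(Γσ) - ⟪e,W(Γσ)⟫e + σe = σe`
    have : W (Γ σ) - (⟪e, W (Γ σ)⟫ : ℝ) • e = 0 := by
      have := congrArg (fun v => v - σ • e) h
      simpa using this
    exact sub_eq_zero.1 this
  refine ⟨δ, hδ, min ρ₁ δ, lt_min hρ₁ hδ, Γ, ?_, ?_, ?_, hcoord, hpar, ?_⟩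
  · -- `C²` on `(−δ, δ)`
    have hlin : ContDiff ℝ 2 (fun σ : ℝ => σ • e) := contDiff_id.smul contDiff_const
    refine hCu.comp hlin.contDiffOn ?_
    intro σ hσ
    exact (hδu (hte σ hσ)).1
  · simp [hΓdef, hsymm0]
  · -- `Γ'(0) = e`
    have h1 : HasDerivAt (fun σ : ℝ => σ • e) e 0 := by
      simpa using (hasDerivAt_id (0 : ℝ)).smul_const e
    have h2' : HasFDerivAt H.symm (T.symm : E →L[ℝ] E) ((fun σ : ℝ => σ • e) 0) := by simpa using hsymmD
    have h3 := h2'.comp_hasDerivAt (0 : ℝ) h1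
    have hTe : T e = e := by
      have : (T : E →L[ℝ] E) e = e := by
        rw [hT]
        simp [hLe, he]
      exact this
    have hTse : T.symm e = e := by
      rw [ContinuousLinearEquiv.symm_apply_eq]; exact hTe.symm
    have h4 : (T.symm : E →L[ℝ] E) e = e := hTse
    simpa [hΓdef, Function.comp_def, h4] using h3
  · -- zeros in `B(z₀, ρ)` lie on the graph
    intro y hy hWy
    have hys : y ∈ H.source := hρ₁s (ball_subset_ball (min_le_left _ _) hy)
    have hin : |(⟪e, y - z₀⟫ : ℝ)| < δ := by
      have h1 : |(⟪e, y - z₀⟫ : ℝ)| ≤ ‖e‖ * ‖y - z₀‖ := abs_real_inner_le_norm e (y - z₀)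
      rw [he, one_mul] at h1
      have h2 : ‖y - z₀‖ < δ := by
        have := ball_subset_ball (min_le_right ρ₁ δ) hy
        rwa [mem_ball, dist_eq_norm] at this
      exact lt_of_le_of_lt h1 h2
    refine ⟨abs_lt.1 hin, ?_⟩
    have hΨy : Ψ y = (⟪e, y - z₀⟫ : ℝ) • e := by simp [hΨdef, hWy]
    have h := H.left_inv hys
    rw [hHcoe, hΨy] at h
    exact h

end Hilbert

/-! ### The symmetric case on `ℝ³` -/

/-- **Bordered invertibility for a symmetric operator with kernel line `ℝe`.**  On `ℝ³`, if `A` is symmetric,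
`Ae = 0` for a unit `e`, and `ker A ∩ e^⊥ = 0`, then `⟪e, A v⟫ = 0` for all `v` and the bordered operator
`A + ⟪e,·⟫e` is a linear homeomorphism `T` with `T = A − ⟪e, A·⟫e + ⟪e,·⟫e` (the modified chart operator of
`exists_kernelGraph_of_corankOne`). [folklore] -/
theorem borderedEquiv_of_isSymmetric {A : EuclideanSpace ℝ (Fin 3) →L[ℝ] EuclideanSpace ℝ (Fin 3)}
    (hA : (A : EuclideanSpace ℝ (Fin 3) →ₗ[ℝ] EuclideanSpace ℝ (Fin 3)).IsSymmetric)
    {e : EuclideanSpace ℝ (Fin 3)} (hAe : A e = 0)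
    (hker : ∀ v, A v = 0 → ⟪e, v⟫ = 0 → v = 0) :
    ∃ T : EuclideanSpace ℝ (Fin 3) ≃L[ℝ] EuclideanSpace ℝ (Fin 3),
      (T : EuclideanSpace ℝ (Fin 3) →L[ℝ] EuclideanSpace ℝ (Fin 3)) =
        A - ((innerSL ℝ e).comp A).smulRight e + (innerSL ℝ e).smulRight e := by
  -- `⟪e, A v⟫ = ⟪A e, v⟫ = 0`
  have horth : ∀ v, ⟪e, A v⟫ = 0 := by
    intro v
    have := hA e v
    simp only [ContinuousLinearMap.coe_coe] at this
    rw [← this, hAe, inner_zero_left]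
  set S : EuclideanSpace ℝ (Fin 3) →L[ℝ] EuclideanSpace ℝ (Fin 3) :=
    A - ((innerSL ℝ e).comp A).smulRight e + (innerSL ℝ e).smulRight e with hS
  have hSapply : ∀ v, S v = A v + (⟪e, v⟫ : ℝ) • e := by
    intro v
    simp only [hS, add_apply, sub_apply,
      ContinuousLinearMap.smulRight_apply, ContinuousLinearMap.comp_apply, innerSL_apply_apply, horth v,
      zero_smul, sub_zero]
  -- injective
  have hinj : Function.Injective S := by
    intro v w hvw
    have h0 : S (v - w) = 0 := by rw [map_sub, hvw, sub_self]
    rw [hSapply] at h0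
    have h1 : (⟪e, v - w⟫ : ℝ) * ⟪e, e⟫ = 0 := by
      have := congrArg (fun u => (⟪e, u⟫ : ℝ)) h0
      simp only [inner_add_right, inner_smul_right, horth, zero_add, inner_zero_right] at this
      linarith
    by_cases he0 : e = 0
    · -- then `S = A` and `A (v - w) = 0`, `⟪e, ·⟫ = 0`
      have hA0 : A (v - w) = 0 := by simpa [he0] using h0
      exact sub_eq_zero.1 (hker _ hA0 (by simp [he0]))
    · have hee : (⟪e, e⟫ : ℝ) ≠ 0 := by
        rw [real_inner_self_eq_norm_sq]; exact pow_ne_zero 2 (norm_ne_zero_iff.2 he0)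
      have h2 : (⟪e, v - w⟫ : ℝ) = 0 := (mul_eq_zero.1 h1).resolve_right hee
      have hA0 : A (v - w) = 0 := by rw [h2, zero_smul, add_zero] at h0; exact h0
      exact sub_eq_zero.1 (hker _ hA0 h2)
  -- bijective (finite dimension) ⇒ continuous linear equivalence
  have hbij : Function.Bijective (S : EuclideanSpace ℝ (Fin 3) →ₗ[ℝ] EuclideanSpace ℝ (Fin 3)) :=
    ⟨hinj, LinearMap.surjective_of_injective hinj⟩
  refine ⟨(LinearEquiv.ofBijective (S : EuclideanSpace ℝ (Fin 3) →ₗ[ℝ] EuclideanSpace ℝ (Fin 3))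
    hbij).toContinuousLinearEquiv, ?_⟩
  ext v
  rfl

end Summit.NavierStokesRegularity.NavierStokesRegularity.Theorems.PowerGaugeEulerLiouville.NodalContinuum
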